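import Summits.RiemannHypothesis.RiemannHypothesis.Theorems.HandoffWindow
import Summits.RiemannHypothesis.RiemannHypothesis.Theorems.MotivicDoorSemilocalThreshold
import Literature.NumberTheory.LFunctions.WeilSemilocalEventuallyNegative
import Literature.NumberTheory.LFunctions.WeilGroundEnergyParitySplit
import Literature.NumberTheory.LFunctions.WeilGroundEnergyProofs
import HarnessLib

/-!
# HANDOFF, analytic form and interface (cell rh-explicit, TRACK «HANDOFF», seat theory-2): the two functionals on the Mellin side, by sector, and what a certificate must say to give `H(q)`

HONEST FRAMING. Nothing here proves or approaches RH. This file sits ON TOP of the track's file of record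
`Theorems/HandoffWindow.lean` (prove-2: `deficit`, `contribution`, `ConsecutivePrimes`, `HandoffH q q'`,
`handoffH_iff_weilPositivityOn`, `riemannHypothesis_iff_forall_handoffH`) and adds ONLY what that file does not
contain — the analytic (Mellin-side) form of the two functionals, their additivity in the PLACES at fixed test
function, the threshold / ground-energy / sector readings of `H(q)`, and the exact shape of the certified inequality
that yields `H(q)` for the cell's A1 ladder.  Companion markdown: `HOME/handoff/HANDOFF-STATEMENT.md` §H (theory-2).

Notation: `q < q'` consecutive primes, `S_q = Nat.primesBelow q`, `k = g ⋆ g̃`, `w_q = 2 log q/√q`, window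
`I_q = [(log q)/2, (log q')/2]`, `ε(t) = weilGroundEnergy t` (infimum of `Re Q(g)/‖g‖₂²` over `C(t)`), `ε_ev`, `ε_od` the
even/odd sector infima (`weilEvenGroundEnergy`, `weilOddGroundEnergy`), `a*(S) = weilSemilocalThreshold S`.

## What is proved (standard axioms, no named facts, no sorry)

* §1 ADDITIVITY IN THE PLACES AT FIXED `g` (`re_weilSemilocalQuadratic_insert`): for every finite `S`, every prime `q ∉ S`
  and every test `g`, `Re Q_{S ∪ {q}}(g) = Re Q_S(g) − Re W_q(k)` with the local Weil term of the place `q` AS PRINTED,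
  `W_q(k) = Σ_{m ≥ 1} (log q) q^{-m/2}(k(m log q) + k(−m log q))` (`= weilSemilocalPrimeTerm {q} k`; Connes–Consani 2023 §2.1
  `W_p(F) = (log p) Σ_m p^{-m/2}(F(p^m) + F(p^{-m}))`; ALL powers of `q`).  Hence the cell's measured NON-additivity `I_S` is a
  statement about bottom EIGENVALUES (the extremal `g` moves with `S`), never about the form at fixed `g`.  On the window
  the place term IS the single atom: `contribution q g = −Re W_q(k)` (`contribution_eq_neg_re_weilSemilocalPrimeTerm`).
* §2 THE MELLIN SIDE (Yoshida 1992 §2 (2.1); tree `weilSemilocalAnalytic`): `deficit q g = −E_{S_q,N}(g)` on `C((log (N+1))/2)`,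
  `E_{S,N}(g) = 2 Re(ĝ(0) conj ĝ(1)) − (log π)‖g‖₂² + (1/2π)∫|ĝ(½+iτ)|² (Re ψ(¼+iτ/2) − Σ_{n ≤ N, S-smooth} (Λ(n)/√n) 2cos(τ log n)) dτ`
  (`deficit_eq_neg_weilSemilocalAnalytic`), and for EVERY test `g` (no window)
  `contribution q g = −(log q/√q)·(1/2π)∫|ĝ(½+iτ)|²·2cos(τ log q) dτ` (`contribution_eq_ripple`): the contribution of `q` is
  minus the `q`-ripple of the spectral weight — the object the A1/A4 engines integrate against their trigonometric sections.
* §3 THRESHOLD READING (`handoffH_iff_le_weilSemilocalThreshold`): `H(q) ↔ (log q')/2 ≤ a*(S_{q'})`, `S_{q'} = primesBelow q'`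
  — literally the cell's C-I(a) LOWER clause at the next prime (the RH-implied one), in the cell's typed vocabulary.
* §4 GROUND-ENERGY / SECTOR READING: `H(q) ↔ 0 ≤ ε((log q')/2)` (`handoffH_iff_weilGroundEnergy_nonneg`), `ε = min(ε_ev, ε_od)`
  (tree `weilGroundEnergy_eq_min_even_odd`: BOTH sectors are needed); the minimum of `ε` over the window is its value at the
  RIGHT END POINT (`isLeast_weilGroundEnergy_window`: no `t`-grid and no modulus of continuity is needed, `ε` is antitone);
  and THE CERTIFICATE SHAPE: one pair `0 ≤ ε_ev(c)`, `0 ≤ ε_od(c)` at ANY single `c ≥ (log q')/2` gives `H(q)`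
  (`handoffH_of_sector_energies`; the A1 K(t)-closure brackets certify exactly such pairs, as DATA — a Lean rung
  `WeilPositivityOn c` gives the same, `handoffH_of_weilPositivityOn`).  Also the directive's literal target shape with the
  base clause named: `RH ↔ WeilPositivityOn((log 2)/2) ∧ ∀ consecutive q < q', H(q)` (`riemannHypothesis_iff_base_and_forall_handoffH`).

References (as printed): H. Yoshida, Adv. Stud. Pure Math. 21 (1992) §2 pp. 287–288 eq. (2.1), Prop. 6 p. 320
(`Yoshida1992HermitianForms`); E. Bombieri, Rend. Mat. Acc. Lincei (9) 11 (2000) Thm 2 p. 193, §4 Problem 2 and Thm 5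
(`Bombieri2000Weil`); A. Connes, C. Consani, Enseign. Math. 69 (2023) §2.1 (`W_p`, `ψ`), §2.2–2.4 (`ConnesConsani2023`);
A. Connes, Selecta Math. 5 (1999) §VII Thm 4 (`Connes1999`).
-/

set_option linter.dupNamespace false  -- the mandated namespace repeats `RiemannHypothesis`

noncomputable section

open Set Filter Complex MeasureTheory Literature.NumberTheory.LFunctions
open Summit.RiemannHypothesis.RiemannHypothesis.Theorems.Handoff
open Summit.RiemannHypothesis.RiemannHypothesis.Theorems.MotivicDoor.SemilocalThreshold
open Summit.RiemannHypothesis.RiemannHypothesis.Theorems.MotivicDoor.Semilocal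
open scoped Real ComplexConjugate

namespace Summit.RiemannHypothesis.RiemannHypothesis.Theorems.HandoffAnalytic

variable {g : ℝ → ℂ} {S : Finset ℕ} {q q' : ℕ}

/-! ## §1  Additivity in the places at fixed `g`; the place term of `q` with all its powers -/

/-- The `S`-smooth coefficient is additive over a new prime: for `q` prime, `q ∉ S` and every `n`,
`Λ_{S ∪ {q}}(n)/√n = Λ_S(n)/√n + Λ_{{q}}(n)/√n`. [folklore] -/
theorem weilSemilocalCoeff_insert (hq : q.Prime) (hqS : q ∉ S) (n : ℕ) :
    weilSemilocalCoeff (insert q S) n = weilSemilocalCoeff S n + weilSemilocalCoeff {q} n := by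
  by_cases hn : IsPrimePow n
  · obtain ⟨p, m, hp, hm, rfl⟩ := (isPrimePow_nat_iff n).1 hn
    have hpf : (p ^ m).primeFactors = {p} := Nat.primeFactors_prime_pow hm.ne' hp
    unfold weilSemilocalCoeff
    simp only [hpf, Finset.singleton_subset_iff, Finset.mem_insert, Finset.mem_singleton]
    by_cases hpq : p = q
    · subst hpq
      simp [hqS]
    · by_cases hpS : p ∈ S
      · simp [hpq, hpS]
      · simp [hpq, hpS]
  · rw [weilSemilocalCoeff_of_not_isPrimePow _ hn, weilSemilocalCoeff_of_not_isPrimePow _ hn,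
      weilSemilocalCoeff_of_not_isPrimePow _ hn, add_zero]

/-- For a bounded kernel `k` the semi-local prime series converges absolutely. [folklore] -/
theorem summable_weilSemilocalPrimeTerm_summand (S : Finset ℕ) {k : ℝ → ℂ} {K : ℝ} (hK : ∀ x, ‖k x‖ ≤ K) :
    Summable fun n : ℕ ↦ (weilSemilocalCoeff S n : ℂ) * (k (Real.log n) + k (-Real.log n)) := by
  have hbound : ∀ n : ℕ, ‖(weilSemilocalCoeff S n : ℂ) * (k (Real.log n) + k (-Real.log n))‖ ≤
      weilSemilocalCoeff S n * (2 * K) := by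
    intro n
    rw [norm_mul, Complex.norm_real, Real.norm_of_nonneg (weilSemilocalCoeff_nonneg _ _)]
    refine mul_le_mul_of_nonneg_left ?_ (weilSemilocalCoeff_nonneg _ _)
    calc ‖k (Real.log n) + k (-Real.log n)‖ ≤ ‖k (Real.log n)‖ + ‖k (-Real.log n)‖ := norm_add_le _ _
      _ ≤ K + K := add_le_add (hK _) (hK _)
      _ = 2 * K := by ring
  exact (Summable.of_nonneg_of_le (fun _ ↦ norm_nonneg _) hbound
    ((summable_weilSemilocalCoeff S).mul_right _)).of_norm

/-- **Additivity of the prime term in the places**: `W^{primes}_{S ∪ {q}}(k) = W^{primes}_S(k) + W_q(k)` for a bounded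
kernel, `q` prime, `q ∉ S`, `W_q = weilSemilocalPrimeTerm {q}` (all powers `q^m`).
[cite: ConnesConsani2023, §2.1 (W_p(F) = (log p) Σ_m p^{-m/2}(F(p^m) + F(p^{-m}))) and §2.1.2 (ψ = … − Σ_p W_p)] -/
theorem weilSemilocalPrimeTerm_insert (hq : q.Prime) (hqS : q ∉ S) {k : ℝ → ℂ} {K : ℝ} (hK : ∀ x, ‖k x‖ ≤ K) :
    weilSemilocalPrimeTerm (insert q S) k = weilSemilocalPrimeTerm S k + weilSemilocalPrimeTerm {q} k := by
  unfold weilSemilocalPrimeTerm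
  rw [← (summable_weilSemilocalPrimeTerm_summand S hK).tsum_add (summable_weilSemilocalPrimeTerm_summand {q} hK)]
  refine tsum_congr fun n ↦ ?_
  rw [weilSemilocalCoeff_insert hq hqS n]
  push_cast
  ring

/-- **Additivity of the semi-local form in the places, at FIXED `g`**: for every finite `S`, every prime `q ∉ S` and
every test `g`, `Re Q_{S ∪ {q}}(g) = Re Q_S(g) − Re W_q(g ⋆ g̃)`. [cite: Connes1999, §VII Thm 4 (the S-local Weil sum is a sum over v ∈ S)] -/
theorem re_weilSemilocalQuadratic_insert (hq : q.Prime) (hqS : q ∉ S) (hg : IsWeilTest g) :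
    (weilSemilocalQuadratic (insert q S) g).re =
      (weilSemilocalQuadratic S g).re - (weilSemilocalPrimeTerm {q} (weilConv g (weilReflect g))).re := by
  have hk : IsWeilTest (weilConv g (weilReflect g)) := hg.weilConv hg.weilReflect
  obtain ⟨K, hK⟩ := hk.1.continuous.bounded_above_of_compact_support hk.2
  unfold weilSemilocalQuadratic weilSemilocalFunctional
  rw [weilSemilocalPrimeTerm_insert hq hqS hK]
  simp only [Complex.sub_re, Complex.add_re]
  ring

/-- The primes `< q'` are the primes `≤ q`: `primesBelow q' = primesBelow (q + 1)` for consecutive primes. [folklore] -/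
theorem _root_.Summit.RiemannHypothesis.RiemannHypothesis.Theorems.Handoff.ConsecutivePrimes.primesBelow_eq
    (h : ConsecutivePrimes q q') : Nat.primesBelow q' = Nat.primesBelow (q + 1) := by
  ext p
  rw [Nat.mem_primesBelow, Nat.mem_primesBelow]
  constructor
  · rintro ⟨hlt, hp⟩
    refine ⟨Nat.lt_succ_of_le ?_, hp⟩
    by_contra hle
    exact absurd (h.2.2.2 p hp (not_le.1 hle)) (not_le.2 hlt)
  · rintro ⟨hlt, hp⟩
    exact ⟨lt_of_le_of_lt (Nat.lt_succ_iff.1 hlt) h.2.2.1, hp⟩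

/-- `0 < (log q')/2`. [folklore] -/
theorem _root_.Summit.RiemannHypothesis.RiemannHypothesis.Theorems.Handoff.ConsecutivePrimes.log_half_pos
    (h : ConsecutivePrimes q q') : 0 < Real.log q' / 2 := by
  have : (1 : ℝ) < q' := by exact_mod_cast h.2.1.one_lt
  have := Real.log_pos this
  positivity

/-- **Prime powers, honestly**: on the window of the consecutive primes `q < q'` the place term of `q` with ALL its
powers is the single atom — `contribution q g = −Re W_q(g ⋆ g̃)` for every test `g ∈ C((log q')/2)` (`q^m`, `m ≥ 2`, is
invisible: `q² ≥ 2q ≥ q'`, Bertrand). [cite: ConnesConsani2023, §2.2 (W_p(F) = p^{-1/2} log p (θ(log p) + θ(−log p)) on log 2 ≤ L < log 3)] -/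
theorem contribution_eq_neg_re_weilSemilocalPrimeTerm (h : ConsecutivePrimes q q') (hg : IsWeilTest g)
    (hsupp : tsupport g ⊆ Icc (-(Real.log q' / 2)) (Real.log q' / 2)) :
    contribution q g = -(weilSemilocalPrimeTerm {q} (weilConv g (weilReflect g))).re := by
  have hins := re_weilSemilocalQuadratic_insert (S := Nat.primesBelow q) h.1 (Nat.notMem_primesBelow q) hg
  have hsucc : Nat.primesBelow (q + 1) = insert q (Nat.primesBelow q) := by
    rw [Nat.primesBelow_succ, if_pos h.1]
  have hsupp' : tsupport g ⊆ Icc (-(Real.log (((q' - 1 : ℕ) : ℝ) + 1) / 2)) (Real.log (((q' - 1 : ℕ) : ℝ) + 1) / 2) := by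
    rwa [h.cast_pred_add_one]
  have hatom := congrArg Complex.re
    (weilSemilocalQuadratic_primesBelow_succ hg h.1 (Nat.le_sub_one_of_lt h.2.2.1) h.pred_lt_sq hsupp')
  rw [hsucc, hins, Complex.sub_re, Complex.re_ofReal_mul] at hatom
  unfold contribution
  linarith

/-! ## §2  The Mellin side -/

/-- **The deficit on the Mellin side** (Yoshida's analytic form): for `tsupport g ⊆ [−(log (N+1))/2, (log (N+1))/2]`,
`deficit q g = −E_{S_q,N}(g)` with `E_{S,N}(g) = 2Re(ĝ(0) conj ĝ(1)) − (log π)‖g‖₂² + (1/2π)∫|ĝ(½+iτ)|² w_{S,N}(τ) dτ`,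
`w_{S,N}(τ) = Re ψ(¼ + iτ/2) − Σ_{n ≤ N, S-smooth} (Λ(n)/√n) 2cos(τ log n)` (`weilSemilocalAnalytic`).
[cite: Yoshida1992HermitianForms, explicit-formula display p. 281 (k = ℚ) and eq. (1.6) p. 284 (the (𝔭,m)-terms; here p ∈ S, p^m ≤ N), §2 p. 287 (F̂ = |φ̂|²); the cosine form of the (𝔭,m)-terms is Fourier inversion, folklore — erratum to the earlier locator «§2 eq. (2.1)», which is the lower bound AFTER the (𝔭,m)-terms are estimated (handoff-lit LIT-ASPRINTED §17F)] -/
theorem deficit_eq_neg_weilSemilocalAnalytic (hg : IsWeilTest g) (q N : ℕ)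
    (hsupp : tsupport g ⊆ Icc (-(Real.log ((N : ℝ) + 1) / 2)) (Real.log ((N : ℝ) + 1) / 2)) :
    deficit q g = -weilSemilocalAnalytic (Nat.primesBelow q) N g := by
  unfold deficit
  rw [re_weilSemilocalQuadratic_eq_weilSemilocalAnalytic hg _ N hsupp]

/-- **The contribution on the Mellin side**: for EVERY test `g` (no window needed),
`contribution q g = −(log q/√q)·(1/2π)∫|ĝ(½+iτ)|²·2cos(τ log q) dτ` — minus the `q`-ripple of the spectral weight
(Plancherel for `k(x) + k(−x)`, tree `weilConv_weilReflect_add_eq_integral`).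
[cite: Yoshida1992HermitianForms, eq. (1.6) p. 284 (the p-term) with §2 p. 287 (F̂ = |φ̂|²); the integral of |φ̂|² against 2cos(t log p) is Fourier inversion, folklore (erratum to the earlier locator «§2 eq. (2.1)», handoff-lit LIT-ASPRINTED §17F)] -/
theorem contribution_eq_ripple (hg : IsWeilTest g) (q : ℕ) :
    contribution q g = -(Real.log q / Real.sqrt q *
      (1 / (2 * π) * ∫ t : ℝ, ‖weilMellin g (1 / 2 + t * I)‖ ^ 2 * (2 * Real.cos (t * Real.log q)))) := by
  unfold contribution
  rw [weilConv_weilReflect_add_eq_integral hg (Real.log q)]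
  have e : (1 / (2 * π) : ℂ) = ((1 / (2 * π) : ℝ) : ℂ) := by push_cast; rfl
  rw [e, ← Complex.ofReal_mul, Complex.ofReal_re]

/-! ## §3  The threshold reading: `H(q)` is the C-I(a) lower clause at the next prime -/

/-- `H(q)` in semi-local language: `H(q) ↔ WeilSemilocalPositivityOn S_{q'} ((log q')/2)`, `S_{q'} = primesBelow q'`
(locality: every prime power `≤ q' − 1` has its prime `≤ q`). [folklore] -/
theorem handoffH_iff_weilSemilocalPositivityOn (h : ConsecutivePrimes q q') :
    HandoffH q q' ↔ WeilSemilocalPositivityOn (Nat.primesBelow q') (Real.log q' / 2) := by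
  rw [handoffH_iff_weilPositivityOn h, h.primesBelow_eq, ← h.cast_pred_add_one,
    weilSemilocalPositivityOn_iff_weilPositivityOn_of_forall (S := Nat.primesBelow (q + 1)) (N := q' - 1)
      (primeFactors_subset_primesBelow_succ_of_gap h.gap)]

/-- **`H(q) ↔ (log q')/2 ≤ a*(S_{q'})`**: the handoff inequality of `q` is the cell's C-I(a) LOWER clause at the next
prime `q'` (`a* = weilSemilocalThreshold`, `S_{q'} = Nat.primesBelow q' = (Finset.range q').filter Nat.Prime`).
[cite: Yoshida1992HermitianForms, Prop. 6 (p. 320), with the primes restricted to S] -/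
theorem handoffH_iff_le_weilSemilocalThreshold (h : ConsecutivePrimes q q') :
    HandoffH q q' ↔ Real.log q' / 2 ≤ weilSemilocalThreshold (Nat.primesBelow q') := by
  rw [handoffH_iff_weilSemilocalPositivityOn h, weilSemilocalPositivityOn_iff_le_weilSemilocalThreshold]

/-! ## §4  The ground-energy / sector reading and the certificate shape -/

/-- **`H(q) ↔ 0 ≤ ε((log q')/2)`** (`ε = weilGroundEnergy`, Bombieri's Problem 2 infimum on the `L²` sphere of the window).
[cite: Bombieri2000Weil, §4 Problem 2 (p. 194) and Thm 5 (p. 199)] -/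
theorem handoffH_iff_weilGroundEnergy_nonneg (h : ConsecutivePrimes q q') :
    HandoffH q q' ↔ 0 ≤ weilGroundEnergy (Real.log q' / 2) := by
  rw [handoffH_iff_weilPositivityOn h, weilGroundEnergy_nonneg_iff_holds h.log_half_pos]

/-- The sector split at the window's end: `ε((log q')/2) = min (ε_ev, ε_od)` — BOTH sector infima enter `H(q)`.
[cite: Yoshida1992HermitianForms, §2 p. 287 (K_odd(a) ⊥ K_even(a) for ( , ))] -/
theorem weilGroundEnergy_window_end_eq_min (q' : ℕ) :
    weilGroundEnergy (Real.log q' / 2) =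
      min (weilEvenGroundEnergy (Real.log q' / 2)) (weilOddGroundEnergy (Real.log q' / 2)) :=
  weilGroundEnergy_eq_min_even_odd _

/-- **No grid, no modulus of continuity**: on the window `[(log q)/2, (log q')/2]` the pointwise margin `t ↦ ε(t)` attains
its minimum at the RIGHT end point (`ε` is antitone). [cite: Bombieri2000Weil, §4 Thm 5 (p. 199), μ(M) decreasing] -/
theorem isLeast_weilGroundEnergy_window (h : ConsecutivePrimes q q') :
    IsLeast (weilGroundEnergy '' Icc (Real.log q / 2) (Real.log q' / 2)) (weilGroundEnergy (Real.log q' / 2)) := by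
  have hq1 : (1 : ℝ) < q := by exact_mod_cast h.1.one_lt
  have hqq' : Real.log q / 2 ≤ Real.log q' / 2 := by
    have h1 : (q : ℝ) ≤ q' := by exact_mod_cast h.2.2.1.le
    linarith [Real.log_le_log (by linarith) h1]
  refine ⟨⟨_, ⟨hqq', le_rfl⟩, rfl⟩, ?_⟩
  rintro _ ⟨t, ⟨ht1, ht2⟩, rfl⟩
  have ht0 : 0 < t := lt_of_lt_of_le (by have := Real.log_pos hq1; positivity) ht1
  exact weilGroundEnergy_anti ht0 ht2

/-- **THE CERTIFICATE SHAPE for the ladder**: one pair of sector inequalities `0 ≤ ε_ev(c)`, `0 ≤ ε_od(c)` at ANY single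
bandwidth `c ≥ (log q')/2` gives `H(q)` (and, by `handoffH_anti`, every earlier `H`).
[cite: Bombieri2000Weil, §4 (Problem 2, Thm 5); Yoshida1992HermitianForms Prop. 6 (p. 320)] -/
theorem handoffH_of_sector_energies (h : ConsecutivePrimes q q') {c : ℝ} (hc : Real.log q' / 2 ≤ c)
    (hev : 0 ≤ weilEvenGroundEnergy c) (hod : 0 ≤ weilOddGroundEnergy c) : HandoffH q q' := by
  have hc0 : 0 < c := lt_of_lt_of_le h.log_half_pos hc
  have hε : 0 ≤ weilGroundEnergy c := by
    rw [weilGroundEnergy_eq_min_even_odd]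
    exact le_min hev hod
  exact (handoffH_iff_weilPositivityOn h).2 (((weilGroundEnergy_nonneg_iff_holds hc0).1 hε).mono hc)

/-- A Lean rung `WeilPositivityOn c`, `c ≥ (log q')/2`, gives `H(q)`. [folklore] -/
theorem handoffH_of_weilPositivityOn (h : ConsecutivePrimes q q') {c : ℝ} (hc : Real.log q' / 2 ≤ c)
    (hW : WeilPositivityOn c) : HandoffH q q' :=
  (handoffH_iff_weilPositivityOn h).2 (hW.mono hc)

/-- **The directive's target shape with the base clause NAMED**: `RH ↔ Base ∧ ∀ consecutive primes q < q', H(q)` with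
`Base := WeilPositivityOn ((log 2)/2)` (a THEOREM of the tree, `weilPositivityOn_log_two_half_holds`; Yoshida 1992 Thm 1),
so the conjunction is equivalent to the base-free form `riemannHypothesis_iff_forall_handoffH` of the file of record.
[cite: Bombieri2000Weil, Thm 2 (p. 193); Yoshida1992HermitianForms Thm 1 (p. 310)] -/
theorem riemannHypothesis_iff_base_and_forall_handoffH :
    Summit.RiemannHypothesis ↔
      WeilPositivityOn (Real.log 2 / 2) ∧ ∀ q q' : ℕ, ConsecutivePrimes q q' → HandoffH q q' := by
  rw [Summit.RiemannHypothesis_iff, riemannHypothesis_iff_forall_handoffH]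
  exact ⟨fun h ↦ ⟨weilPositivityOn_log_two_half_holds, h⟩, fun h ↦ h.2⟩

end Summit.RiemannHypothesis.RiemannHypothesis.Theorems.HandoffAnalytic

end
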